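import Summits.CriticalPhenomena.CardyFormulaZ2.Theorems.CardyComplexConeParafermionToSLESixFamiliesFlipRLDict
import Summits.CriticalPhenomena.CardyFormulaZ2.Theorems.CardySusyWardParafermionFamiliesToSLESixVertexCornerBridge
import HarnessLib
import Literature.Probability.LatticeModels.MedialWindingBridge

/-!
# The staggered corner mode is the in-minus-out mode: `stagger E E.δ (x, i) = (−1)^{i+1} · inOut E s(x, x + eᵢ)`
(line `flip-involution-return-law` of crux `CardyComplexCone.ParafermionToSLESixFamilies`, stmt-CriticalPhenomena-11389;
the dart bookkeeping that plugs the return law into the S0 stub `stub_staggerSummed`)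

The diagonal-staggered combination `stagger = G(NW) − G(NE) + G(SE) − G(SW)` of the four spin-`1/3` corner
observables at a lattice edge `z = s(x, x + eᵢ)` (`…IicDefs.lean`; corner table `medialCornersAt` of the
barrier file `FKParafermionicHalfCauchyRiemann`) is, up to the sign `(−1)^{i+1}`, the expectation `inOut E z`
of the line's in-minus-out visit sum (`…FlipDefs.lean`): every medial edge is oriented with its primal vertex
on the left, so of the four corners at `z` two ARRIVE at `z` (targets `z`: `NE`, `SW` for a horizontal edge,
`NW`, `SE` for a vertical one) and two LEAVE `z`; the corner integrand of an arriving dart at a visit is the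
phase of the winding on arrival, that of a leaving dart the phase of the winding on departure
(registered sub-goal `stagger_eq_signed_inOut`). Consequently (with `inOut_eq_tilt_form` and the landed
`stub_returnLaw`) the summed S0 statement `StaggerSummedVanishing` is literally the summed phase-tilt law
`Y₊ ≈ w⋆ S₁`.

Proof: pathwise along the cut orbit (`cornerSum_explorationList` of the vertex–corner bridge file, a SIGNED
version of its corner table lemma `sum_ite_corner_eq`, and `arrW_explorationList`), then integration
(`integrable_comp_medialExploration'`).
-/

noncomputable section

namespace Summit.CriticalPhenomena.CardyFormulaZ2.Cruxes.ParafermionToSLESixFamilies.FlipInvolutionReturnLaw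

open MeasureTheory Filter Set Metric
open scoped BigOperators
open Literature.Probability Literature.Probability.LatticeModels Literature.Probability.Percolation
open Literature.Barriers.CriticalPhenomena (medialCornersAt medialVertexOf cornerEdge_medialCornersAt
  isCorner_medialCornersAt medialCornersAt_injective)
open Summit.CriticalPhenomena.CardyFormulaZ2.Cruxes.ParafermionToSLESixFamilies.IicTraceFluxPairing (G stagger)
open Summit.CriticalPhenomena.CardyFormulaZ2.Cruxes.ParafermionToSLESixFamilies.CaratheodoryNetSlitUniformity (Pc)
open Summit.CriticalPhenomena.CardyFormulaZ2.Theorems.ParafermionFamiliesToSLESix.StripAnchored.S1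
  (cornerSource_of_coded cornerTarget_of_coded exists_idx_of_cSrc_eq exists_idx_of_cTgt_eq cSrc_ne_cTgt
   idx_eq_of_cornerSource_eq_of_cornerTarget_eq cornerSource_eq_or_cornerTarget_eq cornerSum_explorationList
   integrable_comp_medialExploration')
open Summit.CriticalPhenomena.CardyFormulaZ2.Theorems.ParafermionPrecompact.Negative (headEdge_mem_zdABEdges)

/-! ## The signed corner table at a medial vertex -/

/-- The stagger sign of the `k`-th corner (`NW, NE, SE, SW ↦ +, −, +, −`). -/
theorem staggerSign_cases (k : Fin 4) :
    ((if k = 0 ∨ k = 2 then 1 else -1 : ℂ)) = 1 ∨ ((if k = 0 ∨ k = 2 then 1 else -1 : ℂ)) = -1 := by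
  split_ifs <;> simp

/-- **Which darts are corners at `z`, with the stagger signs.** For a coded corner `r` and a weight `c`,
the signed sum over the four corners at `z = s(x, x + eᵢ)` of `c·[r is that corner]` is
`(−1)^{i+1}·(c·[target of r is z] − c·[source of r is z])`: the arriving corners of a horizontal edge are
`NE`, `SW` (sign `−`), of a vertical edge `NW`, `SE` (sign `+`), and the leaving ones carry the opposite sign. -/
theorem signed_sum_ite_corner_eq (x : Site 2) (i : Fin 2) (r : Site 2 × Fin 4) (c : ℂ) :
    (∑ k : Fin 4, (if k = 0 ∨ k = 2 then 1 else -1 : ℂ) *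
        (if cSrc r = cornerSource (medialCornersAt x i k).1 (medialCornersAt x i k).2 ∧
          cTgt r = cornerTarget (medialCornersAt x i k).1 (medialCornersAt x i k).2 then c else 0)) =
      (if i = 0 then -1 else 1 : ℂ) *
        ((if cTgt r = medialVertexOf (x, i) then c else 0) - (if cSrc r = medialVertexOf (x, i) then c else 0)) := by
  have key : ∀ k : Fin 4, r.1 = (medialCornersAt x i k).1 → cFace r = (medialCornersAt x i k).2 →
      (∑ k' : Fin 4, (if k' = 0 ∨ k' = 2 then 1 else -1 : ℂ) *
        (if cSrc r = cornerSource (medialCornersAt x i k').1 (medialCornersAt x i k').2 ∧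
          cTgt r = cornerTarget (medialCornersAt x i k').1 (medialCornersAt x i k').2 then c else 0)) =
        (if k = 0 ∨ k = 2 then 1 else -1 : ℂ) * c := by
    intro k h1 h2
    rw [Finset.sum_eq_single k]
    · rw [if_pos (show cSrc r = cornerSource (medialCornersAt x i k).1 (medialCornersAt x i k).2 ∧
          cTgt r = cornerTarget (medialCornersAt x i k).1 (medialCornersAt x i k).2 from
        ⟨(cornerSource_of_coded h1 h2).symm, (cornerTarget_of_coded h1 h2).symm⟩)]
    · intro k' _ hne
      have hc : ¬ (cSrc r = cornerSource (medialCornersAt x i k').1 (medialCornersAt x i k').2 ∧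
          cTgt r = cornerTarget (medialCornersAt x i k').1 (medialCornersAt x i k').2) := by
        rintro ⟨hs, ht⟩
        refine hne (idx_eq_of_cornerSource_eq_of_cornerTarget_eq (x := x) (i := i) ?_ ?_)
        · rw [← hs, cornerSource_of_coded h1 h2]
        · rw [← ht, cornerTarget_of_coded h1 h2]
      rw [if_neg hc, mul_zero]
    · exact fun h => absurd (Finset.mem_univ k) h
  -- the explicit in/out tables (as in `exists_idx_of_cSrc_eq` / `exists_idx_of_cTgt_eq`)
  by_cases hs : cSrc r = medialVertexOf (x, i)
  · have ht : cTgt r ≠ medialVertexOf (x, i) := fun h => cSrc_ne_cTgt r (hs.trans h.symm)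
    rw [if_neg ht, if_pos hs, zero_sub]
    -- a LEAVING corner: `NW` or `SE` (horizontal), `NE` or `SW` (vertical)
    obtain ⟨v, j⟩ := r
    simp only [cSrc, medialVertexOf] at hs
    rcases Sym2.eq_iff.1 hs with ⟨rfl, h2⟩ | ⟨rfl, h2⟩
    · have hu : cornerUnit j = Pi.single i 1 := add_left_cancel h2
      fin_cases i <;> fin_cases j <;> (try exact absurd hu (by decide))
      · rw [key 0 (by simp [medialCornersAt]) (by simp [cFace, faceAt, cornerOff, medialCornersAt])]; simp
      · rw [key 3 (by simp [medialCornersAt]) (by simp [cFace, faceAt, cornerOff, medialCornersAt])]; simp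
    · have hu : cornerUnit j = -Pi.single i 1 := by
        have h3 : x + (Pi.single i 1 + cornerUnit j) = x + 0 := by rwa [← add_assoc, add_zero]
        exact eq_neg_of_add_eq_zero_right (add_left_cancel h3)
      fin_cases i <;> fin_cases j <;> (try exact absurd hu (by decide))
      · rw [key 2 (by simp [medialCornersAt]) (by simp [cFace, faceAt, cornerOff, medialCornersAt]; abel)]; simp
      · rw [key 1 (by simp [medialCornersAt]) (by simp [cFace, faceAt, cornerOff, medialCornersAt])]; simp
  · by_cases ht : cTgt r = medialVertexOf (x, i)
    · rw [if_pos ht, if_neg hs, sub_zero]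
      -- an ARRIVING corner: `SW` or `NE` (horizontal), `SE` or `NW` (vertical)
      obtain ⟨v, j⟩ := r
      simp only [cTgt, medialVertexOf] at ht
      rcases Sym2.eq_iff.1 ht with ⟨rfl, h2⟩ | ⟨rfl, h2⟩
      · have hu : cornerUnit (j + 1) = Pi.single i 1 := add_left_cancel h2
        fin_cases i <;> fin_cases j <;> (try exact absurd hu (by decide))
        · rw [key 3 (by simp [medialCornersAt]) (by simp [cFace, faceAt, cornerOff, medialCornersAt])]; simp
        · rw [key 2 (by simp [medialCornersAt]) (by simp [cFace, faceAt, cornerOff, medialCornersAt])]; simp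
      · have hu : cornerUnit (j + 1) = -Pi.single i 1 := by
          have h3 : x + (Pi.single i 1 + cornerUnit (j + 1)) = x + 0 := by rwa [← add_assoc, add_zero]
          exact eq_neg_of_add_eq_zero_right (add_left_cancel h3)
        fin_cases i <;> fin_cases j <;> (try exact absurd hu (by decide))
        · rw [key 1 (by simp [medialCornersAt]) (by simp [cFace, faceAt, cornerOff, medialCornersAt])]; simp
        · rw [key 0 (by simp [medialCornersAt]) (by simp [cFace, faceAt, cornerOff, medialCornersAt])]; simp
    · rw [if_neg hs, if_neg ht, sub_zero, mul_zero]
      refine Finset.sum_eq_zero fun k _ => ?_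
      have hc : ¬ (cSrc r = cornerSource (medialCornersAt x i k).1 (medialCornersAt x i k).2 ∧
          cTgt r = cornerTarget (medialCornersAt x i k).1 (medialCornersAt x i k).2) := by
        rintro ⟨hs', ht'⟩
        rcases cornerSource_eq_or_cornerTarget_eq x i k with h | h
        · exact hs (hs'.trans h)
        · exact ht (ht'.trans h)
      rw [if_neg hc, mul_zero]

/-! ## Pathwise: the signed corner sum along the cut orbit is the in-minus-out sum -/

section Pathwise

variable {β : BondConfig (Site 2)} {c₀ : Site 2 × Fin 4}

/-- Along the cut orbit through a medial vertex `z` other than its first and last, the in-minus-out sum is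
the sum over the darts `orb n`, `n < N`, of `+phase` of the winding after `n` steps if the dart arrives at
`z` and `−phase` of it if the dart leaves `z`. -/
theorem inOutSum_explorationList {δ : ℝ} (hδ : δ ≠ 0) (N : ℕ) {z : MedialVertex}
    (h0 : cSrc (cornerOrbit β c₀ 0) ≠ z) (hN : cSrc (cornerOrbit β c₀ N) ≠ z) :
    inOutSum (explorationList β c₀ N) δ z =
      ∑ n ∈ Finset.range N,
        ((if cTgt (cornerOrbit β c₀ n) = z then
            Complex.exp (-(Complex.I / 3) * ((∑ j ∈ Finset.range n, turnOf β (cornerOrbit β c₀ j) : ℝ) : ℂ))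
          else 0) -
         (if cSrc (cornerOrbit β c₀ n) = z then
            Complex.exp (-(Complex.I / 3) * ((∑ j ∈ Finset.range n, turnOf β (cornerOrbit β c₀ j) : ℝ) : ℂ))
          else 0)) := by
  -- the positions of `z` are the `k ≤ N` with `cSrc (orb k) = z`, i.e. `1 ≤ k ≤ N - 1`
  have hw : ∀ n, n + 1 ≤ N → phase (arrW (explorationList β c₀ N) δ (n + 1)) =
      Complex.exp (-(Complex.I / 3) * ((∑ j ∈ Finset.range n, turnOf β (cornerOrbit β c₀ j) : ℝ) : ℂ)) := by
    intro n hn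
    rw [arrW_explorationList hδ hn, Nat.add_sub_cancel, sum_turnOf_eq, phase]
  rw [inOutSum, length_explorationList']
  have hfilt : (Finset.range (N + 1)).filter (fun k => (explorationList β c₀ N)[k]? = some z) =
      (Finset.range (N + 1)).filter (fun k => cSrc (cornerOrbit β c₀ k) = z) := by
    refine Finset.filter_congr fun k hk => ?_
    rw [Finset.mem_range] at hk
    rw [explorationList, getElem?_map_range, if_pos hk, Option.some.injEq]
  rw [hfilt, Finset.sum_filter]
  have e1 : ∀ k ∈ Finset.range (N + 1),
      (if cSrc (cornerOrbit β c₀ k) = z then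
          phase (arrW (explorationList β c₀ N) δ k) - phase (arrW (explorationList β c₀ N) δ (k + 1)) else 0) =
        (if cSrc (cornerOrbit β c₀ k) = z then phase (arrW (explorationList β c₀ N) δ k) else 0) -
          (if cSrc (cornerOrbit β c₀ k) = z then phase (arrW (explorationList β c₀ N) δ (k + 1)) else 0) := by
    intro k _
    split_ifs <;> simp
  rw [Finset.sum_congr rfl e1, Finset.sum_sub_distrib]
  -- arrival phases: position `k = n + 1` carries `z` iff the dart `orb n` arrives at `z` (position `0` is `e_a`);
  -- departure phases: position `k = n` carries `z` iff the dart `orb n` leaves `z` (position `N` is `e_b`)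
  rw [Finset.sum_range_succ' _ N, if_neg h0, add_zero, Finset.sum_range_succ _ N, if_neg hN, add_zero,
    ← Finset.sum_sub_distrib]
  refine Finset.sum_congr rfl fun n hn => ?_
  rw [Finset.mem_range] at hn
  rw [show cSrc (cornerOrbit β c₀ (n + 1)) = cTgt (cornerOrbit β c₀ n) from cSrc_nextCorner _]
  congr 1
  · split_ifs with h
    · exact hw n (by omega)
    · rfl
  · split_ifs with h
    · exact hw n (by omega)
    · rfl

/-- **Pathwise signed bridge**: along the cut orbit through `z = s(x, x + eᵢ)` other than its first and last
medial vertex, the stagger-signed sum of the four corner integrands is `(−1)^{i+1}` times the in-minus-out sum. -/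
theorem signed_cornerSum_eq_inOutSum {δ : ℝ} (hδ : δ ≠ 0) (N : ℕ) (p : Site 2 × Fin 2)
    (h0 : cSrc (cornerOrbit β c₀ 0) ≠ medialVertexOf p) (hN : cSrc (cornerOrbit β c₀ N) ≠ medialVertexOf p) :
    (∑ k : Fin 4, (if k = 0 ∨ k = 2 then 1 else -1 : ℂ) *
        ∑ n ∈ (Finset.range (explorationList β c₀ N).length).filter (fun n =>
          (explorationList β c₀ N)[n]? =
              some (cornerSource (medialCornersAt p.1 p.2 k).1 (medialCornersAt p.1 p.2 k).2) ∧
            (explorationList β c₀ N)[n + 1]? =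
              some (cornerTarget (medialCornersAt p.1 p.2 k).1 (medialCornersAt p.1 p.2 k).2)),
          Complex.exp (-(Complex.I / 3) *
            ((Polyline.winding (((explorationList β c₀ N).map (medialPoint δ)).take (n + 2)) : ℝ) : ℂ))) =
      (if p.2 = 0 then -1 else 1 : ℂ) * inOutSum (explorationList β c₀ N) δ (medialVertexOf p) := by
  obtain ⟨x, i⟩ := p
  rw [inOutSum_explorationList hδ N h0 hN, Finset.mul_sum]
  simp only [cornerSum_explorationList hδ, Finset.mul_sum]
  rw [Finset.sum_comm]
  refine Finset.sum_congr rfl fun n _ => ?_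
  have := signed_sum_ite_corner_eq x i (cornerOrbit β c₀ n)
    (Complex.exp (-(Complex.I / 3) * ((∑ j ∈ Finset.range n, turnOf β (cornerOrbit β c₀ j) : ℝ) : ℂ)))
  simpa only [mul_ite, mul_zero] using this

end Pathwise

/-! ## The stub -/

/-- **The staggered corner mode is the signed in-minus-out mode** (registered sub-goal
`stagger_eq_signed_inOut` of stmt-CriticalPhenomena-11389, line `flip-involution-return-law`): for
`ℤ²`-admissible data `E` and every lattice edge `z = s(x, x + eᵢ)` off the two `A`–`B` edges,
`stagger E E.δ (x, i) = (−1)^{i+1} · inOut E z` (`−inOut` for a horizontal edge, `+inOut` for a vertical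
one). With `stub_returnLaw` and `inOut_eq_tilt_form`: `‖stagger‖ = |g(1) − g(−1)| · ‖Yplus − w⋆·S1‖` at
every interior edge of Jordan admissible data, so `StaggerSummedVanishing` is the summed tilt law. -/
theorem stagger_eq_signed_inOut : ∀ (E : DiscreteDobrushin), E.IsZdAdmissible → ∀ p : Site 2 × Fin 2, medialVertexOf p ∉ E.zdABEdges → stagger E E.δ p = (if p.2 = 0 then -1 else 1 : ℂ) * inOut E (medialVertexOf p) := by
  intro E hE p hp
  have hδ : E.δ ≠ 0 := hE.delta_pos.ne'
  have h0 : ∀ ω, cSrc (cornerOrbit (E.bcBondConfig ω) (DiscreteDobrushin.startCorner hE) 0) ≠ medialVertexOf p :=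
    fun ω h => hp (h ▸ headEdge_mem_zdABEdges hE)
  have hN : ∀ ω, cSrc (cornerOrbit (E.bcBondConfig ω) (DiscreteDobrushin.startCorner hE) (DiscreteDobrushin.exitTime hE ω)) ≠
      medialVertexOf p := by
    intro ω h
    obtain ⟨M, hM⟩ : ∃ M, DiscreteDobrushin.exitTime hE ω = M + 1 :=
      ⟨DiscreteDobrushin.exitTime hE ω - 1, by have := DiscreteDobrushin.exitTime_pos hE ω; omega⟩
    rw [hM, cSrc_cornerOrbit_succ] at h
    refine hp (h ▸ cTgt_exit_mem_zdABEdges hE (DiscreteDobrushin.isStartCorner_startCorner hE) ?_ ?_)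
    · exact DiscreteDobrushin.isInnerFace_of_lt_exitTime hE ω (by omega)
    · rw [← hM]; exact DiscreteDobrushin.not_isInnerFace_exitTime hE ω
  set Φ : Fin 4 → List MedialVertex → ℂ := fun k γ => ∑ n ∈ (Finset.range γ.length).filter (fun n =>
      γ[n]? = some (cornerSource (medialCornersAt p.1 p.2 k).1 (medialCornersAt p.1 p.2 k).2) ∧
        γ[n + 1]? = some (cornerTarget (medialCornersAt p.1 p.2 k).1 (medialCornersAt p.1 p.2 k).2)),
    Complex.exp (-(Complex.I / 3) * ((Polyline.winding ((γ.map (medialPoint E.δ)).take (n + 2)) : ℝ) : ℂ))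
    with hΦ
  -- buildfix 2026-08-20 (proof-only, regime-robust): `cornerObs` (inside `G`) spells the fully-qualified
  -- `…LatticeModels.winding` (= `FermionicObservable`'s copy when in the closure), `Φ` the `Polyline` copy; bridge them.
  have hG : ∀ k : Fin 4, G E E.δ p k = ∫ ω, Φ k (medialExploration E ω) ∂Pc := fun k => by
    rw [hΦ]
    first
      | rfl
      | (unfold G Summit.CriticalPhenomena.CardyFormulaZ2.Cruxes.EdgePrecompact.QkzStripBoundaryArm.cornerObs;
         simp only [Literature.Probability.LatticeModels.Polyline.winding_eq_winding'])
  have hpt : ∀ ω, (∑ k : Fin 4, (if k = 0 ∨ k = 2 then 1 else -1 : ℂ) * Φ k (medialExploration E ω)) =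
      (if p.2 = 0 then -1 else 1 : ℂ) * inOutSum (medialExploration E ω) E.δ (medialVertexOf p) := by
    intro ω
    rw [DiscreteDobrushin.medialExploration_eq_explorationList hE ω]
    exact signed_cornerSum_eq_inOutSum hδ _ p (h0 ω) (hN ω)
  have hst : stagger E E.δ p = ∑ k : Fin 4, (if k = 0 ∨ k = 2 then 1 else -1 : ℂ) * G E E.δ p k := by
    rw [stagger, Fin.sum_univ_four, if_pos (by decide), if_neg (by decide), if_pos (by decide), if_neg (by decide)]
    ring
  rw [hst, inOut, ← integral_const_mul]
  simp only [hG, ← integral_const_mul]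
  rw [← integral_finsetSum _ fun k _ => (integrable_comp_medialExploration' hE (Φ k)).const_mul _]
  exact integral_congr_ae (Eventually.of_forall hpt)

end Summit.CriticalPhenomena.CardyFormulaZ2.Cruxes.ParafermionToSLESixFamilies.FlipInvolutionReturnLaw

end
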